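import Summits.CriticalPhenomena.PercolationContinuityZ3.Theorems.PercNearOneGluingNoHeavyQuantFarBlockLaw
import HarnessLib

/-!
# QUANT lane R8, front "FAR beyond trees", layer one — THE SHIELDED-RELAY LEMMA

builds on p205010 (kernel theorem, internal audit signed; external expert review pending)

Support file (`--supports stmt-CriticalPhenomena-4575`), seat `prim-quant-p1` (gen 25); memo
`run/shared/lean/prim/quant/prim-quant-p1-g25/FOR-LEAD-TWOTERMINAL.md` §3.  Standard axioms; no sorries; no definitions.

An elementary but useful certificate for the layer-one far-relay row (`Quant.FarRelayRow`, `j = 1`): a relay `a ≠ o` is SHIELDED if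
every vertex `u ≠ a` joined to `a` by a pair of positive weight is itself a relay.  Then almost surely every open path from the
observer to `a` passes, just before `a`, through another reached relay, so `{o ↔ a} ⊆ {N ≥ 2}` and
* **`Quant.real_card_le_one_le_of_shielded`**: `P(#{x ∈ A : o ↔ x} ≤ 1) ≤ P(o ↮ a)` — for EVERY finite weighted graph, with no
  hypothesis on the mean and none on the rest of the graph;
* `Quant.farLayerOne_of_shielded`: hence `P(o ↮ x) ≤ t` on `A` gives `P(N ≤ 1) ≤ t` (the `j = 1` conclusion of `Quant.FarRelayRow`).
Consequence for the structure of a minimal counterexample to FAR at layer one (memo §3): no relay has all its neighbours in `A`; in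
particular a decorated ear of a 2-connected core never carries three consecutive sure relays (the deterministic case of the two-terminal
exit lemma `Block.real_card_le_one_le_of_exit₂`, `…QuantFarTwoTerminalExit`).
[cite: Grimmett1999, §1.3 p. 10] (open paths; weight-zero pairs are a.s. closed); the lemma is [this work].
-/

noncomputable section

namespace Summit.CriticalPhenomena.PercolationContinuityZ3.Theorems

namespace Quant

open Finset MeasureTheory Set
open Literature.Probability.LatticeModels
open Literature.Probability.Percolation
open scoped Classical

variable {n : ℕ}

/-- **Combinatorial core**: if every open pair at `a` other than loops joins `a` to a relay, and `o ≠ a` is joined to `a`, then at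
least two relays are joined to `o` (namely `a` and the last-but-one vertex of an open path from `o` to `a`). [this work] -/
theorem two_le_card_of_shielded {ω : BondConfig (Fin n)} {A : Finset (Fin n)} {o a : Fin n} (hoa : o ≠ a) (haA : a ∈ A)
    (hsh : ∀ u : Fin n, u ≠ a → s(a, u) ∈ ω → u ∈ A) (h : (openGraph ω).Reachable o a) :
    2 ≤ (A.filter fun x => ω ∈ openConn o x).card := by
  obtain ⟨p⟩ := h.symm
  cases p with
  | nil => exact absurd rfl hoa
  | cons hadj q =>
    rename_i u
    rw [openGraph_adj] at hadj
    obtain ⟨he, hne⟩ := hadj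
    have huA : u ∈ A := hsh u (Ne.symm hne) he
    have hou : (openGraph ω).Reachable o u := q.reachable.symm
    have hsub : ({a, u} : Finset (Fin n)) ⊆ A.filter fun x => ω ∈ openConn o x := by
      intro x hx
      rw [mem_filter]
      rcases mem_insert.1 hx with rfl | hx
      · exact ⟨haA, h⟩
      · rw [mem_singleton.1 hx]; exact ⟨huA, hou⟩
    calc 2 = ({a, u} : Finset (Fin n)).card := by rw [card_pair hne]
      _ ≤ _ := card_le_card hsub

/-- **The shielded-relay lemma.**  For every finite weighted graph `w` on `Fin n`, relay set `A`, observer `o` and relay `a ∈ A`, `a ≠ o`,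
such that every `u ≠ a` with `w(s(a,u)) ≠ 0` lies in `A`: `P(#{x ∈ A : o ↔ x} ≤ 1) ≤ P(o ↮ a)`. [this work] -/
theorem real_card_le_one_le_of_shielded (w : Sym2 (Fin n) → unitInterval) (A : Finset (Fin n)) {o a : Fin n} (hoa : o ≠ a)
    (haA : a ∈ A) (hsh : ∀ u : Fin n, u ≠ a → (w s(a, u) : ℝ) ≠ 0 → u ∈ A) :
    (prodBernoulli w).real {ω : BondConfig (Fin n) | (A.filter fun x => ω ∈ openConn o x).card ≤ 1} ≤
      (prodBernoulli w).real (openConn o a : Set (BondConfig (Fin n)))ᶜ := by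
  set μ := prodBernoulli w with hμ
  have hmeas : ∀ U : Set (BondConfig (Fin n)), MeasurableSet U := fun U => (Set.toFinite U).measurableSet
  -- the pairs at `a` towards non-relays have weight zero, hence are almost surely closed
  set Bd : Finset (Sym2 (Fin n)) := Finset.univ.filter fun e => ∃ u : Fin n, u ≠ a ∧ e = s(a, u) ∧ u ∉ A with hBd
  set Nbad : Set (BondConfig (Fin n)) := {ω | ∃ e ∈ Bd, e ∈ ω} with hN
  have hN0 : μ.real Nbad = 0 := by
    have h0 : μ Nbad = 0 := by
      apply prodBernoulli_setOf_exists_mem_eq_zero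
      intro e he
      obtain ⟨u, hua, rfl, huA⟩ := (Finset.mem_filter.1 he).2
      by_contra hne
      exact huA (hsh u hua hne)
    simp [measureReal_def, h0]
  set S := {ω : BondConfig (Fin n) | (A.filter fun x => ω ∈ openConn o x).card ≤ 1} with hS
  -- off the bad event, `S ⊆ {o ↮ a}`
  have hsub : S \ Nbad ⊆ (openConn o a : Set (BondConfig (Fin n)))ᶜ := by
    rintro ω ⟨hωS, hωN⟩ hωa
    have hsh' : ∀ u : Fin n, u ≠ a → s(a, u) ∈ ω → u ∈ A := by
      intro u hua he
      by_contra huA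
      exact hωN ⟨s(a, u), Finset.mem_filter.2 ⟨Finset.mem_univ _, u, hua, rfl, huA⟩, he⟩
    have h2 := two_le_card_of_shielded hoa haA hsh' hωa
    simp only [hS, mem_setOf_eq] at hωS
    omega
  have hsplit : μ.real S = μ.real (S \ Nbad) := by
    have h := measureReal_inter_add_sdiff (μ := μ) (s := S) (hmeas Nbad)
    have h0 : μ.real (S ∩ Nbad) = 0 :=
      le_antisymm ((measureReal_mono Set.inter_subset_right).trans hN0.le) measureReal_nonneg
    linarith
  rw [hsplit]
  exact measureReal_mono hsub (measure_ne_top _ _)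

/-- **FAR at layer one from a shielded relay** (route vocabulary): if some relay `a ∈ A`, `a ≠ o`, has all its positive-weight
neighbours in `A`, then `P(o ↮ x) ≤ t` for all `x ∈ A` implies `P(#{x ∈ A : o ↔ x} ≤ 1) ≤ t` (no mean hypothesis needed). [this work] -/
theorem farLayerOne_of_shielded (w : Sym2 (Fin n) → unitInterval) (A : Finset (Fin n)) {o a : Fin n} (hoa : o ≠ a)
    (haA : a ∈ A) (hsh : ∀ u : Fin n, u ≠ a → (w s(a, u) : ℝ) ≠ 0 → u ∈ A) (t : ℝ)
    (hcut : ∀ x ∈ A, (prodBernoulli w).real (openConn o x : Set (BondConfig (Fin n)))ᶜ ≤ t) :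
    (prodBernoulli w).real {ω : BondConfig (Fin n) | (A.filter fun x => ω ∈ openConn o x).card ≤ 1} ≤ t :=
  (real_card_le_one_le_of_shielded w A hoa haA hsh).trans (hcut a haA)

end Quant

end Summit.CriticalPhenomena.PercolationContinuityZ3.Theorems
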